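import Literature.AnabelianGeometry.AbsoluteAnabelian.PanalocalTPairs
import Literature.AnabelianGeometry.AbsoluteAnabelian.TMMonoGroupoid
import HarnessLib

/-!
# [AbsTopIII] Thm 1.9, Def 5.1 (vi), Def 5.6 (ii): identity morphisms for the [hom]-records
# `FundamentalExtension.Hom`, `PanalocalTPairData.Hom`, `PanalocalTPair.Hom`, `MonoAnalyticGaloisTheater.Hom`
# (rows «NV-L4/…», abc-iut-w5-d197 INHABITATION CENSUS L4 v1 §A [hom])

S. Mochizuki, *Topics in absolute anabelian geometry III*, J. Math. Sci. Univ. Tokyo 22 (2015); manuscript pages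
Thm 1.9 p. 38 (homomorphisms of
extensions), Def 5.1 (vi) p. 118 (morphisms of panalocal `T`-pairs), Def 5.6 (ii) p. 135 (morphisms of mono-analytic
Galois-theaters).  PROOF-ONLY companion (no `def`, no `instance`, no `structure`) of abc-iut-L4-t3's `TPairs.lean` /
`PanalocalTPairs.lean` / `PanalocalTheaters.lean` and abc-iut-L4-t1's `FundamentalExtension.lean` (the row `Anab` /
`Anab.Hom` was closed by abc-iut-w5-d197 as a census artefact — L4-t12's functor `Anab.κAn` — and is not repeated
here).  The census lists these [hom] structures with ZERO producers ("witnessed by identities once the object type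
is inhabited"); this file records the identities, kernel-checked and GENERAL (for every object):

* `FundamentalExtension.nonempty_hom_refl` — the identity of the category of extensions (the census cannot see the
  category instance: an artefact, recorded);
* `PanalocalTPairData.nonempty_hom_refl` — identity of panalocal `T`-pair DATA: identity bijections, identity open
  injections (`PanalocalGaloisTheater.isOpenInjection_id`), identity isomorphisms of the `X_v`, identity
  `T`-isomorphisms, Kummer-compatible by the interface law `TPairVocabulary.kummerTransport_refl`;
* `PanalocalTPair.nonempty_hom_refl` — identity of panalocal `T`-pairs over L4's `PanalocalGaloisTheater.Hom.refl`;
* `MonoAnalyticGaloisTheater.nonempty_hom_refl` — identity of mono-analytic Galois-theaters (identity bijection,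
  identity open injections, `TMMono.Iso.refl`).

FINDING (interface, recorded here and on STATUS, no row): the two remaining [hom] rows `GlobalGaloisTheater.Hom` and
`GlobalTPair.Hom` are NOT reflexive as typed — the identity of a global Galois-theater needs
`T.κ v (R.mapKNF (𝟙 _) _ x) = φv.fieldIso (T.κ v x)`, and the interface `GlobalAnabelianContext` records `mapKNF`
(and `mapProVal`) WITHOUT identity/composition laws; `κ_v : k_NF ↪ A_{X_v}` being a mere inclusion, no `fieldIso`
can be manufactured from it.  A law `mapKNF_id : R.mapKNF (𝟙 E) (IsEAHom.id E) = RingEquiv.refl _` (owner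
abc-iut-L4-t3 lineage) would make both identities immediate.

HONEST FRAMING: structural witnesses for OUR typed interfaces; nothing of [AbsTopIII] is asserted; no bearing on, and
no side taken on, [IUTchIII] Cor 3.12.
-/

namespace Literature.AnabelianGeometry.AbsoluteAnabelian

open _root_.CategoryTheory

universe u

/-! ### `FundamentalExtension.Hom` -/

/-- **Thm 1.9 (functoriality clause)** — every extension `1 → Δ → Π → G → 1` has its identity homomorphism (identity
on `Π` and on `G`, square commutes). GENERAL. [cite: MochizukiAbsTopIII2015, Theorem 1.9 p.38] -/
theorem FundamentalExtension.nonempty_hom_refl (E : FundamentalExtension.{u}) : Nonempty (E.Hom E) :=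
  ⟨⟨ContinuousMonoidHom.id _, ContinuousMonoidHom.id _, fun _ => rfl⟩⟩

/-- **Thm 1.9** — the identity homomorphism is a base-change morphism and is the categorical identity.
[cite: MochizukiAbsTopIII2015, Theorem 1.9 p.38] -/
theorem FundamentalExtension.exists_hom_isBaseChange (E : FundamentalExtension.{u}) :
    ∃ f : E.Hom E, f = 𝟙 E ∧ FundamentalExtension.Hom.IsBaseChange f :=
  ⟨𝟙 E, rfl, FundamentalExtension.Hom.IsBaseChange.id E⟩

/-! ### Panalocal `T`-pair data and panalocal `T`-pairs -/

section Panalocal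

variable {R : GlobalAnabelianContext.{u}} {T : TKind} {W : TPairVocabulary R T}

/-- **Def 5.1 (vi)** — GENERAL: every panalocal `T`-pair DATUM has its identity morphism (identity index
bijections, identity open injections of the `Π_v`, identity isomorphisms of the `X_v`, identity `T`-isomorphisms;
Kummer-compatibility by `kummerTransport_refl`). [cite: MochizukiAbsTopIII2015, Definition 5.1 (vi) p.118] -/
theorem PanalocalTPairData.nonempty_hom_refl {Vn Va : Type u} {D : Vn → ProfiniteGrp.{u}}
    {X : Va → AutHolOrbispace.{u}} (P : PanalocalTPairData W Vn Va D X) : Nonempty (P.Hom P) :=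
  ⟨{ eNon := Equiv.refl _
     eArc := Equiv.refl _
     grpHom := fun v => ContinuousMonoidHom.id (D v)
     grpHom_isOpenInjection := fun v => PanalocalGaloisTheater.isOpenInjection_id (D v)
     xIso := fun _ => ⟨Homeomorph.refl _, RingEquiv.refl _, ContinuousMulEquiv.refl _⟩
     φnon := fun v => Iso.refl _
     φnon_equivariant := fun v g => by
       change (P.actNon v g).hom ≫ 𝟙 _ = 𝟙 _ ≫ (P.actNon v g).hom
       rw [Category.comp_id, Category.id_comp]
     φarc := fun v => Iso.refl _
     φarc_kummer := fun v => W.kummerTransport_refl _ }⟩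

/-- **Def 5.1 (vi)** — GENERAL: every panalocal `T`-pair `M✠` has its identity morphism, over the identity
`PanalocalGaloisTheater.Hom.refl` of its theater (abc-iut-L4-t3).
[cite: MochizukiAbsTopIII2015, Definition 5.1 (vi) p.118] -/
theorem PanalocalTPair.nonempty_hom_refl (Q : PanalocalTPair W) : Nonempty (PanalocalTPair.Hom W Q Q) :=
  ⟨{ φV := PanalocalGaloisTheater.Hom.refl Q.theater
     φnon := fun v => Iso.refl _
     φnon_equivariant := fun v g => by
       change (Q.data.actNon v g).hom ≫ 𝟙 _ = 𝟙 _ ≫ (Q.data.actNon v g).hom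
       rw [Category.comp_id, Category.id_comp]
     φarc := fun v => Iso.refl _
     φarc_kummer := fun v => W.kummerTransport_refl _ }⟩

end Panalocal

/-! ### Mono-analytic Galois-theaters -/

/-- **Def 5.6 (ii)** — GENERAL: every mono-analytic Galois-theater `W⊢` has its identity morphism (identity
bijection `φ_W`, classes `|Π|_w`, `|X|_w` unchanged, identity open injections of the `G_w`, `TMMono.Iso.refl` at
archimedean `w`). [cite: MochizukiAbsTopIII2015, Definition 5.6 (ii) p.135] -/
theorem MonoAnalyticGaloisTheater.nonempty_hom_refl {R : GlobalAnabelianContext.{u}}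
    {ma : ArchMonoAnalyticization.{u}} (W : MonoAnalyticGaloisTheater R ma) : Nonempty (W.Hom W) :=
  ⟨{ φW := Equiv.refl _
     φW_generic := rfl
     image_non := by simp
     image_arc := by simp
     non_compat := fun w => ⟨w.2, fun _ => Iff.rfl,
       ⟨ContinuousMonoidHom.id _, PanalocalGaloisTheater.isOpenInjection_id _⟩⟩
     arc_compat := fun w => ⟨w.2, fun _ => Iff.rfl, ⟨TMMono.Iso.refl _⟩⟩ }⟩

end Literature.AnabelianGeometry.AbsoluteAnabelian
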